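import Literature.Barriers.AtomisticToContinuum.DisorderedHarmonicChainIBP
import HarnessLib

/-!
# Ajanki–Huveneers 2011: `L²` orthogonality of predictable martingale transforms on `τ^{⊗(n+1)}`

Sixth file of the integration-by-parts route to the low-frequency upper bound (U) of
`…Transfer.lean` (O. Ajanki, F. Huveneers, CMP **301** (2011) 841–883, arXiv:1003.1076). The
error terms of the integration by parts are sums `∑_k c_k(B) g(B_k)` with PREDICTABLE coefficients
(`c_k` reads only `B_j`, `j < k`) against a centred function `g` of the `k`-th reduced mass
(`g = ℓ`, the logarithmic derivative of `…IBP.lean`, or `g(b) = b`): martingale transforms. This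
file PROVES the orthogonality of their increments,
`𝔼(∑_k c_k g(B_k))² = 𝔼g(B)² · ∑_k 𝔼 c_k²` (`integral_sq_sum_predictable`), from the one-coordinate
independence `integral_pi_mul_coord`; it is the `L²` isometry the paper uses implicitly through
Azuma/Freedman (Lemma 4.2) and that replaces, in our route, the Fourier computation of App. 7.3.

[cite: AjankiHuveneers2011, Lemma 4.2 (martingale structure of `∑ a(X_{k-1})B_k`); folklore (orthogonality of martingale increments)]
-/

noncomputable section

open Real MeasureTheory Finset Function

namespace Literature.Barriers.AtomisticToContinuum.HeatConduction

variable (ρ : Measure ℝ) [IsProbabilityMeasure ρ]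

/-- **Off-diagonal terms vanish**: for `k ≠ l`, predictable `c_k`, `c_l` and centred `g`,
`𝔼[c_k c_l g(B_k) g(B_l)] = 0`. [folklore] -/
theorem integral_offdiag_eq_zero {n : ℕ} (c : Fin (n + 1) → (Fin (n + 1) → ℝ) → ℝ)
    (hpred : ∀ k j : Fin (n + 1), k ≤ j → ∀ B b, c k (update B j b) = c k B)
    (g : ℝ → ℝ) (hg0 : ∫ b, g b ∂ρ = 0) {k l : Fin (n + 1)} (hkl : k ≠ l)
    (hI : Integrable (fun B => c k B * c l B * g (B k) * g (B l)) (Measure.pi fun _ : Fin (n + 1) => ρ)) :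
    ∫ B, c k B * c l B * g (B k) * g (B l) ∂(Measure.pi fun _ : Fin (n + 1) => ρ) = 0 := by
  rcases lt_or_gt_of_ne hkl with h | h
  · -- resample coordinate `l`
    have hF : ∀ B b, (fun B => c k B * c l B * g (B k)) (update B l b) =
        (fun B => c k B * c l B * g (B k)) B := by
      intro B b
      simp only [hpred k l h.le, hpred l l le_rfl, update_of_ne (ne_of_lt h)]
    have := integral_pi_mul_coord ρ l (fun B => c k B * c l B * g (B k)) hF g hI
    rw [this, hg0, mul_zero]
  · have hF : ∀ B b, (fun B => c k B * c l B * g (B l)) (update B k b) =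
        (fun B => c k B * c l B * g (B l)) B := by
      intro B b
      simp only [hpred l k h.le, hpred k k le_rfl, update_of_ne (ne_of_lt h)]
    have hI' : Integrable (fun B => c k B * c l B * g (B l) * g (B k)) (Measure.pi fun _ : Fin (n + 1) => ρ) :=
      hI.congr (ae_of_all _ fun B => by ring)
    have := integral_pi_mul_coord ρ k (fun B => c k B * c l B * g (B l)) hF g hI'
    rw [show (fun B : Fin (n + 1) → ℝ => c k B * c l B * g (B k) * g (B l)) =
        fun B => c k B * c l B * g (B l) * g (B k) from funext fun B => by ring]
    rw [this, hg0, mul_zero]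

/-- **Diagonal terms factor**: `𝔼[c_k² g(B_k)²] = 𝔼c_k² · 𝔼g²`. [folklore] -/
theorem integral_diag_eq {n : ℕ} (c : Fin (n + 1) → (Fin (n + 1) → ℝ) → ℝ)
    (hpred : ∀ k j : Fin (n + 1), k ≤ j → ∀ B b, c k (update B j b) = c k B)
    (g : ℝ → ℝ) (k : Fin (n + 1))
    (hI : Integrable (fun B => c k B ^ 2 * g (B k) ^ 2) (Measure.pi fun _ : Fin (n + 1) => ρ)) :
    ∫ B, c k B ^ 2 * g (B k) ^ 2 ∂(Measure.pi fun _ : Fin (n + 1) => ρ) =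
      (∫ B, c k B ^ 2 ∂(Measure.pi fun _ : Fin (n + 1) => ρ)) * ∫ b, g b ^ 2 ∂ρ := by
  have hF : ∀ B b, (fun B => c k B ^ 2) (update B k b) = (fun B => c k B ^ 2) B := by
    intro B b; simp only [hpred k k le_rfl]
  exact integral_pi_mul_coord ρ k (fun B => c k B ^ 2) hF (fun b => g b ^ 2) hI

/-- **Orthogonality of martingale increments**: for predictable coefficients `c_k` and a centred
`g`, `𝔼(∑_k c_k(B) g(B_k))² = 𝔼 g(B)² · ∑_k 𝔼 c_k(B)²`. [folklore] -/
theorem integral_sq_sum_predictable {n : ℕ} (c : Fin (n + 1) → (Fin (n + 1) → ℝ) → ℝ)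
    (hpred : ∀ k j : Fin (n + 1), k ≤ j → ∀ B b, c k (update B j b) = c k B)
    (g : ℝ → ℝ) (hg0 : ∫ b, g b ∂ρ = 0)
    (hI2 : ∀ k l : Fin (n + 1), Integrable (fun B => c k B * c l B * g (B k) * g (B l))
      (Measure.pi fun _ : Fin (n + 1) => ρ))
    (s : Finset (Fin (n + 1))) :
    ∫ B, (∑ k ∈ s, c k B * g (B k)) ^ 2 ∂(Measure.pi fun _ : Fin (n + 1) => ρ) =
      (∫ b, g b ^ 2 ∂ρ) * ∑ k ∈ s, ∫ B, c k B ^ 2 ∂(Measure.pi fun _ : Fin (n + 1) => ρ) := by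
  set μ := (Measure.pi fun _ : Fin (n + 1) => ρ) with hμ
  have hsq : ∀ B : Fin (n + 1) → ℝ, (∑ k ∈ s, c k B * g (B k)) ^ 2 =
      ∑ k ∈ s, ∑ l ∈ s, c k B * c l B * g (B k) * g (B l) := by
    intro B
    rw [sq, Finset.sum_mul_sum]
    refine Finset.sum_congr rfl fun k _ => Finset.sum_congr rfl fun l _ => by ring
  simp only [hsq]
  rw [integral_finsetSum _ fun k _ => integrable_finsetSum _ fun l _ => hI2 k l]
  have hinner : ∀ k ∈ s, ∫ B, ∑ l ∈ s, c k B * c l B * g (B k) * g (B l) ∂μ =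
      (∫ b, g b ^ 2 ∂ρ) * ∫ B, c k B ^ 2 ∂μ := by
    intro k hk
    rw [integral_finsetSum _ fun l _ => hI2 k l]
    rw [Finset.sum_eq_single_of_mem k hk]
    · have hIk : Integrable (fun B => c k B ^ 2 * g (B k) ^ 2) μ :=
        (hI2 k k).congr (ae_of_all _ fun B => by ring)
      have h := integral_diag_eq ρ c hpred g k hIk
      rw [show (fun B : Fin (n + 1) → ℝ => c k B * c k B * g (B k) * g (B k)) =
          fun B => c k B ^ 2 * g (B k) ^ 2 from funext fun B => by ring, h, mul_comm]
    · intro l _ hlk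
      exact integral_offdiag_eq_zero ρ c hpred g hg0 (Ne.symm hlk) (hI2 k l)
  rw [Finset.sum_congr rfl hinner, ← Finset.mul_sum]

/-- **The `L²` bound** in the form used downstream: with `𝔼g² ≤ v` and `𝔼c_k² ≤ A_k`,
`𝔼(∑_k c_k g(B_k))² ≤ v ∑_k A_k`. [folklore] -/
theorem integral_sq_sum_predictable_le {n : ℕ} (c : Fin (n + 1) → (Fin (n + 1) → ℝ) → ℝ)
    (hpred : ∀ k j : Fin (n + 1), k ≤ j → ∀ B b, c k (update B j b) = c k B)
    (g : ℝ → ℝ) (hg0 : ∫ b, g b ∂ρ = 0) {v : ℝ} (hv : ∫ b, g b ^ 2 ∂ρ ≤ v)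
    (hI2 : ∀ k l : Fin (n + 1), Integrable (fun B => c k B * c l B * g (B k) * g (B l))
      (Measure.pi fun _ : Fin (n + 1) => ρ))
    (s : Finset (Fin (n + 1))) (A : Fin (n + 1) → ℝ)
    (hA : ∀ k ∈ s, ∫ B, c k B ^ 2 ∂(Measure.pi fun _ : Fin (n + 1) => ρ) ≤ A k) :
    ∫ B, (∑ k ∈ s, c k B * g (B k)) ^ 2 ∂(Measure.pi fun _ : Fin (n + 1) => ρ) ≤ v * ∑ k ∈ s, A k := by
  rw [integral_sq_sum_predictable ρ c hpred g hg0 hI2 s]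
  have hg2 : 0 ≤ ∫ b, g b ^ 2 ∂ρ := integral_nonneg fun b => sq_nonneg _
  have hsum : ∑ k ∈ s, ∫ B, c k B ^ 2 ∂(Measure.pi fun _ : Fin (n + 1) => ρ) ≤ ∑ k ∈ s, A k :=
    Finset.sum_le_sum hA
  have hs0 : 0 ≤ ∑ k ∈ s, ∫ B, c k B ^ 2 ∂(Measure.pi fun _ : Fin (n + 1) => ρ) :=
    Finset.sum_nonneg fun k _ => integral_nonneg fun B => sq_nonneg _
  calc (∫ b, g b ^ 2 ∂ρ) * ∑ k ∈ s, ∫ B, c k B ^ 2 ∂(Measure.pi fun _ : Fin (n + 1) => ρ)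
      ≤ v * ∑ k ∈ s, ∫ B, c k B ^ 2 ∂(Measure.pi fun _ : Fin (n + 1) => ρ) :=
        mul_le_mul_of_nonneg_right hv hs0
    _ ≤ v * ∑ k ∈ s, A k := mul_le_mul_of_nonneg_left hsum (hg2.trans hv)

end Literature.Barriers.AtomisticToContinuum.HeatConduction

end
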